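import Literature.Computability.Cryptography.PeriodFindingSums
import Literature.Computability.Cryptography.PeriodFindingCircuit
import Literature.Computability.QuantumComplexity.RevUncompute
import Literature.Computability.Complexity.CodeFPArith
import Literature.Computability.Complexity.CodeFPBudgets
import HarnessLib

/-!
# Fourier sampling of a computed table by eigenvalue estimation of shifts, I: the classical block

Topic `Computability/Cryptography`; first of the files realising the quantum core of Hallgren's
algorithm (Jozsa 2003, §10, proof of Thm. 6: "Construct the state `(1/√q) ∑_m |m⟩|f(m)⟩ …
apply the quantum Fourier transform mod q") in the tree's exact Clifford+T model, for an ARBITRARY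
polynomial-time table `tab x : ℕ → {0,1}*` of the input `x`. The Fourier sampling is realised, as
in `PeriodFinding*.lean` (Kitaev 1995, §3: eigenvalue estimation of the shift `|v⟩ ↦ |v + 1⟩`
on the level sets of the table), by the sandwich circuit `H_{y,Z}; V; S³; H_y` around a classical
block `V` writing, for every unit `u`, the table value at the offset `Z_u` shifted by the exponent
`A_u(y)` of the controls; there the block read an ORACLE, here it is the exact compilation of a
polynomial-time MACHINE reading the input register (the pattern of `ShorModExpBlock.lean`).
Theorem-and-definition file, no named facts.

* `SSParams` — the shape of the experiment as functions of the input length `n`: `nU n` units,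
  block length `L n` (modulus `2^{L n}`), `Lv n` levels, `B n` repetitions; derived counts `K`
  (controls per unit), `k₁`, `k₂` (control / offset wires), `tabLen` (tableau length) and the
  inverse `nOf` (`nOf_tabLen`: the input length is read off the tableau length);
* `blockFn P tab` — the string function of the block: parse the tableau `x ++ ys ++ zs ++ 0 1ⁿ`,
  and write the coded list of the unit values `tab x (shiftMod 2^L (zNum − aNum))`
  (`aNum`: Kitaev's exponent `∑_s y_{u,s} 2^{⌊s/2B⌋}`, `zNum`: the offset of the unit, little
  endian); `blockFn_inpOf` (its value on a well-formed tableau) and **`blockFn_mem_FP`** (it is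
  polynomial time when `tab` is, by the typed algebra `CodeFP`);
* the compiled block, verbatim after `ShorModExpBlock.lean`: the machine `MB`/`eB`
  (`RevClean.exists_outputsWithin_pow_of_mem_FP`), the layout `dataN`/`sufV`/`mW`, **`VB`**
  (`revCompile` of Bennett's compute–copy–uncompute block `RevClean.cleanOps`), `VB_isOracleFree`,
  the semantics **`VB_mulVec_basisState`** (`|x⟩|c⟩|0⟩ ↦ |x⟩|c⟩|resOf x c⟩`) and the fibre lemma
  **`resOf_eq_iff`**: two coin strings give the same work register iff all unit values agree.

## References

* R. Jozsa, *Notes on Hallgren's efficient quantum algorithm for solving Pell's equation*,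
  arXiv:quant-ph/0302134 (2003), §10 (proof of Thm. 6). [Jozsa2003]
* A. Yu. Kitaev, arXiv:quant-ph/9511026 (1995), §2.2 Lemma 1, §3 Lemma 10. [Kitaev1995]
* P. W. Shor, SIAM J. Comput. 26 (1997), §3 p. 8 (compute, copy, undo). [Shor1997]
* C. H. Bennett, IBM J. Res. Develop. 17 (1973), §2. [Bennett1973]
-/

noncomputable section

namespace Literature.Computability.Cryptography

namespace ShiftSampling

open _root_.Computability Complexity Complexity.CodeFP Complexity.Brick QuantumComplexity QuantumComplexity.RevClean
  QuantumComplexity.RevSim Kitaev1995 PeriodFinding Matrix Finset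

/-! ### Parameters -/

/-- **The shape of the shift experiment** as functions of the input length: units, block length,
levels, repetitions (all positive and monotone, so that the tableau length determines the input
length). [cite: Kitaev1995, §3 (Lemma 10, Thm 1)] -/
structure SSParams where
  /-- number of units -/
  nU : ℕ → ℕ
  /-- block length (`Q = 2^L`) -/
  L : ℕ → ℕ
  /-- number of levels -/
  Lv : ℕ → ℕ
  /-- repetitions per test -/
  B : ℕ → ℕ
  /-- there is a unit -/
  nU_pos : ∀ n, 0 < nU n
  /-- blocks are nonempty -/
  L_pos : ∀ n, 0 < L n
  /-- there is a level -/
  Lv_pos : ∀ n, 0 < Lv n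
  /-- there is a repetition -/
  B_pos : ∀ n, 0 < B n
  /-- monotone in the input length -/
  nU_mono : Monotone nU
  /-- monotone in the input length -/
  L_mono : Monotone L
  /-- monotone in the input length -/
  Lv_mono : Monotone Lv
  /-- monotone in the input length -/
  B_mono : Monotone B

namespace SSParams

variable (P : SSParams)

/-- Controls per unit: levels × (types × repetitions). [cite: Kitaev1995, §3 Lemma 10] -/
def K (n : ℕ) : ℕ := P.Lv n * (2 * P.B n)

/-- Control wires. [folklore] -/
def k₁ (n : ℕ) : ℕ := P.nU n * P.K n

/-- Offset wires. [folklore] -/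
def k₂ (n : ℕ) : ℕ := P.nU n * P.L n

/-- Data wires of the block: input and coins. [folklore] -/
def dataN (n : ℕ) : ℕ := n + (P.k₁ n + P.k₂ n)

/-- The tableau length: data plus the suffix `0 1ⁿ`. [folklore] -/
def tabLen (n : ℕ) : ℕ := P.dataN n + (n + 1)

/-- `K > 0`. [folklore] -/
theorem K_pos (n : ℕ) : 0 < P.K n := by
  unfold K; have := P.Lv_pos n; have := P.B_pos n; positivity

/-- `K` is monotone. [folklore] -/
theorem K_mono : Monotone P.K := fun _ _ h =>
  Nat.mul_le_mul (P.Lv_mono h) (Nat.mul_le_mul_left 2 (P.B_mono h))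

/-- `k₁` is monotone. [folklore] -/
theorem k₁_mono : Monotone P.k₁ := fun _ _ h => Nat.mul_le_mul (P.nU_mono h) (P.K_mono h)

/-- `k₂` is monotone. [folklore] -/
theorem k₂_mono : Monotone P.k₂ := fun _ _ h => Nat.mul_le_mul (P.nU_mono h) (P.L_mono h)

/-- `tabLen` is strictly monotone. [folklore] -/
theorem tabLen_strictMono : StrictMono P.tabLen := by
  refine strictMono_nat_of_lt_succ fun n => ?_
  unfold tabLen dataN
  have h1 := P.k₁_mono (Nat.le_add_right n 1)
  have h2 := P.k₂_mono (Nat.le_add_right n 1)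
  omega

/-- `n ≤ tabLen n`. [folklore] -/
theorem le_tabLen (n : ℕ) : n ≤ P.tabLen n := by unfold tabLen dataN; omega

/-- `L n ≤ k₂ n`. [folklore] -/
theorem L_le_k₂ (n : ℕ) : P.L n ≤ P.k₂ n := Nat.le_mul_of_pos_left _ (P.nU_pos n)

/-- `L n * u ≤ k₂ n` for a unit `u`. [folklore] -/
theorem L_mul_le_k₂ {n u : ℕ} (hu : u < P.nU n) : P.L n * u ≤ P.k₂ n := by
  unfold k₂; rw [Nat.mul_comm]; exact Nat.mul_le_mul_right _ hu.le

/-- Counting `m < N` below `n`. [folklore] -/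
theorem length_filter_lt_range (n : ℕ) : ∀ N : ℕ,
    ((List.range N).filter fun m => decide (m < n)).length = min n N
  | 0 => by simp
  | N + 1 => by
    rw [List.range_succ, List.filter_append, List.length_append, length_filter_lt_range n N]
    by_cases h : N < n
    · rw [List.filter_cons_of_pos (by simpa using h)]
      simp; omega
    · rw [List.filter_cons_of_neg (by simpa using h)]
      simp; omega

/-- **The input length read off the tableau length**: the number of `m < len` with
`tabLen (m + 1) ≤ len` (written with a harmless `min` so that the count is visibly a bounded loop).
[folklore] -/
def nOf (len : ℕ) : ℕ :=
  ((List.range len).filter fun m => decide (P.tabLen (min (m + 1) len) ≤ len)).length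

/-- `nOf (tabLen n) = n`. [folklore] -/
theorem nOf_tabLen (n : ℕ) : P.nOf (P.tabLen n) = n := by
  unfold nOf
  have hmono := P.tabLen_strictMono
  rw [List.filter_congr (p := fun m => decide (P.tabLen (min (m + 1) (P.tabLen n)) ≤ P.tabLen n))
    (q := fun m => decide (m < n)) fun m hm => ?_, length_filter_lt_range, min_eq_left (P.le_tabLen n)]
  have hm' : m < P.tabLen n := List.mem_range.1 hm
  rw [min_eq_left (by omega)]
  by_cases h : m < n
  · rw [decide_eq_true (hmono.monotone (by omega : m + 1 ≤ n)), decide_eq_true h]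
  · rw [decide_eq_false (fun h' => h (by have := hmono.le_iff_le.1 h'; omega)), decide_eq_false h]

/-! ### The string function of the block -/

/-- **Kitaev's exponent of unit `u`** read off the control string: `∑_{s < K} y_{Ku+s} 2^{⌊s/2B⌋}`
(control `s` of the unit sits at level `⌊s / 2B⌋`; the `min` is harmless for `s < K`).
[cite: Kitaev1995, §3 Lemma 10 (A(y) = ∑ y_j 2^{level j})] -/
def aNum (n : ℕ) (ys : List Bool) (u : ℕ) : ℕ :=
  ((List.range (P.K n)).map fun s =>
    (ys.getD (P.K n * u + s) false).toNat * 2 ^ min (s / (2 * P.B n)) (P.Lv n)).sum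

/-- **The offset of unit `u`**: its `L` bits, little endian (the `min` is harmless for `u < nU`).
[folklore] -/
def zNum (n : ℕ) (zs : List Bool) (u : ℕ) : ℕ := bitsToNat ((zs.drop (min (P.L n * u) (P.k₂ n))).take (P.L n))

/-- **The argument of the table for unit `u`**: the offset shifted back by the exponent, modulo
`Q = 2^L`, in natural-number arithmetic. [cite: Kitaev1995, §3 Lemma 10 (the shift |v⟩ ↦ |v + A⟩ read backwards)] -/
def unitArg (n : ℕ) (ys zs : List Bool) (u : ℕ) : ℕ :=
  (P.zNum n zs u + 2 ^ P.L n * P.aNum n ys u - P.aNum n ys u) % 2 ^ P.L n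

/-- `unitArg` is the shifted offset `Z_u − A_u (mod 2^L)`. [folklore] -/
theorem unitArg_eq_shiftMod (n : ℕ) (ys zs : List Bool) (u : ℕ) :
    P.unitArg n ys zs u = shiftMod (2 ^ P.L n) ((P.zNum n zs u : ℤ) - P.aNum n ys u) := by
  unfold unitArg shiftMod
  have hQ : 1 ≤ 2 ^ P.L n := Nat.one_le_two_pow
  have hle : P.aNum n ys u ≤ 2 ^ P.L n * P.aNum n ys u := Nat.le_mul_of_pos_left _ (by omega)
  apply Int.ofNat.inj
  rw [Int.ofNat_eq_natCast, Int.ofNat_eq_natCast, Int.toNat_of_nonneg (Int.emod_nonneg _ (by positivity)),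
    Int.natCast_mod, Nat.cast_sub (by omega), Nat.cast_add, Nat.cast_mul, Nat.cast_pow]
  push_cast
  rw [show ((P.zNum n zs u : ℤ) + 2 ^ P.L n * P.aNum n ys u - P.aNum n ys u) =
    ((P.zNum n zs u : ℤ) - P.aNum n ys u) + 2 ^ P.L n * P.aNum n ys u by ring, Int.add_mul_emod_self_left]

/-- The input part of a tableau. [folklore] -/
def xOfTab (s : List Bool) : List Bool := s.take (P.nOf s.length)

/-- The control part of a tableau. [folklore] -/
def ysOfTab (s : List Bool) : List Bool := (s.drop (P.nOf s.length)).take (P.k₁ (P.nOf s.length))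

/-- The offset part of a tableau. [folklore] -/
def zsOfTab (s : List Bool) : List Bool :=
  (s.drop (P.nOf s.length + P.k₁ (P.nOf s.length))).take (P.k₂ (P.nOf s.length))

/-- **The unit values written by the block** for the table `tab`. [cite: Jozsa2003, §10 (proof of Thm. 6: |m⟩|f(m)⟩)] -/
def units (tab : List Bool → ℕ → List Bool) (s : List Bool) : List (List Bool) :=
  (List.range (P.nU (P.nOf s.length))).map fun u =>
    tab (P.xOfTab s) (P.unitArg (P.nOf s.length) (P.ysOfTab s) (P.zsOfTab s) u)

/-- **The string function of the block**: the coded list of the unit values. [cite: Jozsa2003, §10 (proof of Thm. 6)] -/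
def blockFn (tab : List Bool → ℕ → List Bool) (s : List Bool) : List Bool := encList (P.units tab s)

/-- The constant suffix `0 1ⁿ` of the tableau. [folklore] -/
def sufV (n : ℕ) : List Bool := false :: ones n

/-- The suffix has length `n + 1`. [folklore] -/
@[simp] theorem length_sufV (n : ℕ) : (sufV n).length = n + 1 := by simp [sufV]

/-- **The tableau** on input `w`, controls `ys`, offsets `zs`. [folklore] -/
def tabOf (w ys zs : List Bool) : List Bool := w ++ ys ++ zs ++ sufV w.length

variable {P}

section parse

variable {w ys zs : List Bool} (hys : ys.length = P.k₁ w.length) (hzs : zs.length = P.k₂ w.length)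
include hys hzs

/-- The tableau has length `tabLen`. [folklore] -/
theorem length_tabOf : (tabOf w ys zs).length = P.tabLen w.length := by
  simp only [tabOf, List.length_append, hys, hzs, length_sufV, tabLen, dataN]; omega

/-- The block reads the input length off the tableau. [folklore] -/
theorem nOf_length_tabOf : P.nOf (tabOf w ys zs).length = w.length := by
  rw [length_tabOf hys hzs, nOf_tabLen]

/-- The block reads the input off the tableau. [folklore] -/
theorem xOfTab_tabOf : P.xOfTab (tabOf w ys zs) = w := by
  rw [xOfTab, nOf_length_tabOf hys hzs, tabOf, List.append_assoc, List.append_assoc, List.take_left]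

/-- The block reads the controls off the tableau. [folklore] -/
theorem ysOfTab_tabOf : P.ysOfTab (tabOf w ys zs) = ys := by
  rw [ysOfTab, nOf_length_tabOf hys hzs, tabOf, List.append_assoc, List.append_assoc, List.drop_left,
    ← hys, List.take_left]

/-- The block reads the offsets off the tableau. [folklore] -/
theorem zsOfTab_tabOf : P.zsOfTab (tabOf w ys zs) = zs := by
  rw [zsOfTab, nOf_length_tabOf hys hzs, tabOf, List.append_assoc, ← hys, ← List.length_append,
    List.drop_left, ← hzs, List.take_left]

/-- **The block on a tableau** writes the coded list of the unit values. [cite: Jozsa2003, §10 (proof of Thm. 6)] -/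
theorem units_tabOf (tab : List Bool → ℕ → List Bool) : P.units tab (tabOf w ys zs) =
    (List.range (P.nU w.length)).map fun u => tab w (P.unitArg w.length ys zs u) := by
  rw [units, xOfTab_tabOf hys hzs, ysOfTab_tabOf hys hzs, zsOfTab_tabOf hys hzs, nOf_length_tabOf hys hzs]

end parse


/-! ### The block is polynomial time -/

section FP

/-- Bit access by a unary position (a copy of `CodeFPStrings.strGetD`, kept local to lighten the
imports). [cite: AroraBarak2009, §1.3] -/
private theorem strGetD' : CodeFP (pairE unE strE) bitE (fun p => p.2.getD p.1 false) :=
  ⟨HashBricks.headBitFn ∘ bitAtFn, comp_mem_FP HashBricks.headBitFn_mem_FP bitAtFn_mem_FP, fun p => by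
    rw [pairE_apply, Function.comp_apply, bitAtFn_boolPair, HashBricks.headBitFn_apply, length_unE]
    change [((p.2.drop p.1).take 1).headD false] = [p.2.getD p.1 false]
    rw [List.getD_eq_getElem?_getD, ← List.head?_drop]
    cases p.2.drop p.1 <;> rfl⟩

/-- Bit access by a binary position (a copy of `CodeFPStrings.strGetDNat`). [cite: AroraBarak2009, §1.3] -/
private theorem strGetDNat' : CodeFP (pairE strE natE) bitE (fun p => p.1.getD p.2 false) :=
  (strGetD'.comp ((unOfNatMin.comp ((strLength.comp (fst strE natE)).pair (snd strE natE))).pair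
    (fst strE natE))).congr fun p => by
      obtain ⟨w, i⟩ := p
      simp only
      by_cases h : i < w.length
      · rw [min_eq_left h.le]
      · push Not at h
        rw [min_eq_right h, List.getD_eq_default _ _ le_rfl, List.getD_eq_default _ _ h]

/-- Sums of raw lists of binary numerals (a copy of `CodeFPStrings.natSum`). [cite: AroraBarak2009, §1.3] -/
private theorem natSum' : CodeFP (rawE natE) natE List.sum := by
  have h := intToNat.comp (intSum.comp (map₀ intOfNat))
  refine h.congr fun l => ?_
  show ((l.map fun n : ℕ => (n : ℤ)).sum).toNat = l.sum
  rw [← Nat.cast_list_sum, Int.toNat_natCast]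

/-- Unary multiplication by a constant (a copy of `CodeFPStrings.unMulConst`). [folklore] -/
private theorem unMulConst' : ∀ c : ℕ, CodeFP unE unE (fun n => c * n)
  | 0 => (const unE 0).congr fun n => by simp
  | c + 1 => (unAdd.comp ((unMulConst' c).pair (CodeFP.id unE))).congr fun n => by simp [add_mul]

/-- **Unary multiplication** (as `QuantumComplexity.unMul_codeFP`, a private copy to keep the imports light). [cite: AroraBarak2009, §1.3] -/
private theorem unMul : CodeFP (pairE unE unE) unE (fun p => p.1 * p.2) :=
  ((ulength unitE).comp (unitsMul.comp ((replicateUnit.comp (fst unE unE)).pair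
    (replicateUnit.comp (snd unE unE))))).congr fun p => by simp

variable (hnU : CodeFP unE unE P.nU) (hL : CodeFP unE unE P.L) (hLv : CodeFP unE unE P.Lv)
  (hB : CodeFP unE unE P.B)
include hLv hB in
/-- `K` in unary. [folklore] -/
theorem K_un : CodeFP unE unE P.K := (unMul.comp (hLv.pair ((unMulConst' 2).comp hB))).congr fun _ => rfl

include hnU hLv hB in
/-- `k₁` in unary. [folklore] -/
theorem k₁_un : CodeFP unE unE P.k₁ := (unMul.comp (hnU.pair (K_un hLv hB))).congr fun _ => rfl

include hnU hL in
/-- `k₂` in unary. [folklore] -/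
theorem k₂_un : CodeFP unE unE P.k₂ := (unMul.comp (hnU.pair hL)).congr fun _ => rfl

include hnU hL hLv hB in
/-- `tabLen` in unary. [folklore] -/
theorem tabLen_un : CodeFP unE unE P.tabLen :=
  ((unAdd.comp ((unAdd.comp ((CodeFP.id unE).pair (unAdd.comp ((k₁_un hnU hLv hB).pair (k₂_un hnU hL))))).pair
    (unSucc.comp (CodeFP.id unE)))) :).congr fun _ => rfl

include hnU hL hLv hB in
/-- `nOf` in unary (a bounded filter over the range). [folklore] -/
theorem nOf_un : CodeFP unE unE P.nOf := by
  have hmin : CodeFP (pairE unE natE) unE (fun q => min (q.2 + 1) q.1) :=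
    (unOfNatMin.comp ((fst _ _).pair (natAdd.comp ((snd _ _).pair (const _ 1)))) :)
  have hp : CodeFP (pairE unE natE) bitE (fun q => decide (P.tabLen (min (q.2 + 1) q.1) ≤ q.1)) :=
    (unLeNat.comp (((tabLen_un hnU hL hLv hB).comp hmin).pair (natOfUn.comp (fst _ _))) :)
  exact (((ulength natE).comp ((filter hp).comp ((CodeFP.id unE).pair urange))) :).congr fun _ => rfl

include hnU hL hLv hB in
/-- The input length, in unary, from the tableau. [folklore] -/
theorem nOfTab_un : CodeFP strE unE (fun s => P.nOf s.length) := (nOf_un hnU hL hLv hB).comp strLength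

include hnU hL hLv hB in
/-- The input part. [folklore] -/
theorem xOfTab_fp : CodeFP strE strE P.xOfTab := (strTake.comp ((nOfTab_un hnU hL hLv hB).pair (CodeFP.id strE)) :)

include hnU hL hLv hB in
/-- The control part. [folklore] -/
theorem ysOfTab_fp : CodeFP strE strE P.ysOfTab :=
  (strTake.comp (((k₁_un hnU hLv hB).comp (nOfTab_un hnU hL hLv hB)).pair
    (strDrop.comp ((nOfTab_un hnU hL hLv hB).pair (CodeFP.id strE)))) :)

include hnU hL hLv hB in
/-- The offset part. [folklore] -/
theorem zsOfTab_fp : CodeFP strE strE P.zsOfTab :=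
  (strTake.comp (((k₂_un hnU hL).comp (nOfTab_un hnU hL hLv hB)).pair
    (strDrop.comp ((unAdd.comp ((nOfTab_un hnU hL hLv hB).pair ((k₁_un hnU hLv hB).comp (nOfTab_un hnU hL hLv hB)))).pair
      (CodeFP.id strE)))) :)

/-- `Bool.toNat` on codes (as `BravyiGosset.toNat_codeFP`, a private copy). [folklore] -/
private theorem toNat_fp : CodeFP bitE natE Bool.toNat :=
  ((CodeFP.id bitE).ite (const _ 1) (const _ 0)).congr fun b => by cases b <;> rfl

/-- The context of a unit: the tableau and the unit index. [folklore] -/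
abbrev UE : List Bool × ℕ → List Bool := pairE strE natE

include hnU hL hLv hB in
/-- **Kitaev's exponent of a unit is polynomial time** (a bounded sum). [cite: Kitaev1995, §3 Lemma 10] -/
theorem aNum_fp : CodeFP UE natE (fun q => P.aNum (P.nOf q.1.length) (P.ysOfTab q.1) q.2) := by
  have hn : CodeFP UE unE (fun q => P.nOf q.1.length) := (nOfTab_un hnU hL hLv hB).comp (fst _ _)
  -- items `((s, u), t)`
  have hn' : CodeFP (pairE UE natE) unE (fun r => P.nOf r.1.1.length) := hn.comp (fst _ _)
  have hidx : CodeFP (pairE UE natE) natE (fun r => P.K (P.nOf r.1.1.length) * r.1.2 + r.2) :=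
    (natAdd.comp ((natMul.comp ((natOfUn.comp ((K_un hLv hB).comp hn')).pair (fst _ _).snd')).pair (snd _ _)) :)
  have hbit : CodeFP (pairE UE natE) natE (fun r => ((P.ysOfTab r.1.1).getD (P.K (P.nOf r.1.1.length) * r.1.2 + r.2) false).toNat) :=
    (toNat_fp.comp (strGetDNat'.comp (((ysOfTab_fp hnU hL hLv hB).comp (fst _ _).fst').pair hidx)) :)
  have h2B : CodeFP (pairE UE natE) natE (fun r => 2 * P.B (P.nOf r.1.1.length)) :=
    natOfUn.comp ((unMulConst' 2).comp (hB.comp hn'))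
  have hexp : CodeFP (pairE UE natE) unE (fun r => min (r.2 / (2 * P.B (P.nOf r.1.1.length))) (P.Lv (P.nOf r.1.1.length))) :=
    (unOfNatMin.comp ((hLv.comp hn').pair (natDiv.comp ((snd _ _).pair h2B))) :)
  have hitem : CodeFP (pairE UE natE) natE (fun r => ((P.ysOfTab r.1.1).getD (P.K (P.nOf r.1.1.length) * r.1.2 + r.2) false).toNat *
      2 ^ min (r.2 / (2 * P.B (P.nOf r.1.1.length))) (P.Lv (P.nOf r.1.1.length))) :=
    (natMul.comp (hbit.pair (natPow.comp ((const _ 2).pair hexp))) :)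
  have h := (natSum'.comp ((map hitem).comp ((CodeFP.id UE).pair (urange.comp ((K_un hLv hB).comp hn)))) :)
  exact h.congr fun q => rfl

include hnU hL hLv hB in
/-- **The offset of a unit is polynomial time** (a slice, read as a numeral). [folklore] -/
theorem zNum_fp : CodeFP UE natE (fun q => P.zNum (P.nOf q.1.length) (P.zsOfTab q.1) q.2) := by
  have hn : CodeFP UE unE (fun q => P.nOf q.1.length) := (nOfTab_un hnU hL hLv hB).comp (fst _ _)
  have hLu : CodeFP UE natE (fun q => P.L (P.nOf q.1.length) * q.2) :=
    (natMul.comp ((natOfUn.comp (hL.comp hn)).pair (snd _ _)) :)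
  have hamt : CodeFP UE unE (fun q => min (P.L (P.nOf q.1.length) * q.2) (P.k₂ (P.nOf q.1.length))) :=
    (unOfNatMin.comp (((k₂_un hnU hL).comp hn).pair hLu) :)
  have hsl : CodeFP UE strE (fun q => (P.zsOfTab q.1).drop (min (P.L (P.nOf q.1.length) * q.2) (P.k₂ (P.nOf q.1.length)))) :=
    (strDrop.comp (hamt.pair ((zsOfTab_fp hnU hL hLv hB).comp (fst _ _))) :)
  exact (strVal.comp (strTake.comp ((hL.comp hn).pair hsl)) :)

include hnU hL hLv hB in
/-- **The table argument of a unit is polynomial time.** [folklore] -/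
theorem unitArg_fp : CodeFP UE natE (fun q => P.unitArg (P.nOf q.1.length) (P.ysOfTab q.1) (P.zsOfTab q.1) q.2) := by
  have hn : CodeFP UE unE (fun q => P.nOf q.1.length) := (nOfTab_un hnU hL hLv hB).comp (fst _ _)
  have hQ : CodeFP UE natE (fun q => 2 ^ P.L (P.nOf q.1.length)) := (natPow.comp ((const _ 2).pair (hL.comp hn)) :)
  have ha := aNum_fp hnU hL hLv hB
  have hz := zNum_fp hnU hL hLv hB
  have h1 : CodeFP UE natE (fun q => P.zNum (P.nOf q.1.length) (P.zsOfTab q.1) q.2 +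
      2 ^ P.L (P.nOf q.1.length) * P.aNum (P.nOf q.1.length) (P.ysOfTab q.1) q.2) :=
    (natAdd.comp (hz.pair (natMul.comp (hQ.pair ha))) :)
  have h2 : CodeFP UE natE (fun q => P.zNum (P.nOf q.1.length) (P.zsOfTab q.1) q.2 +
      2 ^ P.L (P.nOf q.1.length) * P.aNum (P.nOf q.1.length) (P.ysOfTab q.1) q.2 - P.aNum (P.nOf q.1.length) (P.ysOfTab q.1) q.2) :=
    (natSub.comp (h1.pair ha) :)
  exact (natMod.comp (h2.pair hQ) :)

include hnU hL hLv hB in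
/-- **The unit values are polynomial time** when the table is. [cite: Jozsa2003, §10 Thm. 6 (a)] -/
theorem units_fp {tab : List Bool → ℕ → List Bool} (htab : CodeFP (pairE strE natE) strE fun p => tab p.1 p.2) :
    CodeFP strE (rawE strE) (P.units tab) := by
  have hval : CodeFP UE strE (fun q => tab (P.xOfTab q.1) (P.unitArg (P.nOf q.1.length) (P.ysOfTab q.1) (P.zsOfTab q.1) q.2)) :=
    htab.comp (((xOfTab_fp hnU hL hLv hB).comp (fst _ _)).pair (unitArg_fp hnU hL hLv hB))
  exact (((map hval).comp ((CodeFP.id strE).pair (urange.comp (hnU.comp (nOfTab_un hnU hL hLv hB))))) :).congr fun _ => rfl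

include hnU hL hLv hB in
/-- **The block is polynomial time** when the table is. [cite: Jozsa2003, §10 Thm. 6 (a) and Prop. 36 (ii)] -/
theorem blockFn_mem_FP {tab : List Bool → ℕ → List Bool} (htab : CodeFP (pairE strE natE) strE fun p => tab p.1 p.2) :
    P.blockFn tab ∈ FP := by
  obtain ⟨f, hf, hfe⟩ := units_fp hnU hL hLv hB htab
  have : f = P.blockFn tab := funext fun s => by
    rw [show f s = f (strE s) from rfl, hfe s, rawE, List.map_id]; rfl
  rw [← this]; exact hf

end FP

end SSParams

/-! ### The machine of the block -/

section Machine

variable {f : List Bool → List Bool}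

/-- A polynomial-time machine of `f` with a time bound of the shape `(n+2)^e`. [folklore] -/
theorem exists_blockMachine (hf : f ∈ FP) : ∃ p : (_ : ℕ) × Turing.TM2ComputableAux Bool Bool,
    ∀ u : List Bool, p.2.OutputsWithin u (f u) (Tn p.1 u.length) := by
  obtain ⟨e, M, h⟩ := exists_outputsWithin_pow_of_mem_FP hf
  exact ⟨⟨e, M⟩, h⟩

/-- The exponent of the time bound of the block machine. [folklore] -/
def eB (hf : f ∈ FP) : ℕ := (Classical.choose (exists_blockMachine hf)).1

/-- **The block machine** (a `TM2` machine computing `f` within `(n+2)^{eB}` steps). [folklore] -/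
def MB (hf : f ∈ FP) : Turing.TM2ComputableAux Bool Bool := (Classical.choose (exists_blockMachine hf)).2

/-- The block machine computes `f` within its time bound. [folklore] -/
theorem MB_outputsWithin (hf : f ∈ FP) (u : List Bool) : (MB hf).OutputsWithin u (f u) (Tn (eB hf) u.length) :=
  Classical.choose_spec (exists_blockMachine hf) u

end Machine

/-! ### The layout and the block -/

namespace SSParams

variable (P : SSParams) {tab : List Bool → ℕ → List Bool} (hbf : P.blockFn tab ∈ FP)

/-- The total number of wires of the block. [folklore] -/
def totN (n : ℕ) : ℕ := width (eB hbf) (MB hbf) (P.tabLen n)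

/-- The number of work wires of the block. [folklore] -/
def mW (n : ℕ) : ℕ := P.totN hbf n - P.dataN n

/-- The data wires lie before the work wires. [folklore] -/
theorem dataN_le_totN (n : ℕ) : P.dataN n ≤ P.totN hbf n :=
  ((Nat.le_add_right _ _).trans (le_NN (e := eB hbf) (M := MB hbf) (P.tabLen n))).trans (NN_le_width _)

/-- The layout has the width of the block. [folklore] -/
theorem layoutN_eq (n : ℕ) : n + ((P.k₁ n + P.k₂ n) + P.mW hbf n) = P.totN hbf n := by
  have := P.dataN_le_totN hbf n; unfold mW dataN at *; omega

/-- There is a wire. [folklore] -/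
theorem layoutN_pos (n : ℕ) : 0 < n + ((P.k₁ n + P.k₂ n) + P.mW hbf n) := by
  rw [layoutN_eq]; exact (NN_pos (eB hbf) (MB hbf) _).trans_le (NN_le_width _)

/-- The clean block on `ℕ`-indexed wires. [cite: Shor1997, §3 p.8 (compute F(x) keeping x, copy, undo)] -/
def opsN (n : ℕ) : List (ClOp ℕ) := cleanOps (eB hbf) (MB hbf) (P.dataN n) (sufV n)

/-- The block uses wires of the layout only. [folklore] -/
theorem opsN_lt (n : ℕ) : ∀ op ∈ P.opsN hbf n, ∀ i ∈ wiresOf op, i < n + ((P.k₁ n + P.k₂ n) + P.mW hbf n) := by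
  rw [layoutN_eq]
  intro op hop i hi
  have h := cleanOps_lt (e := eB hbf) (M := MB hbf) op hop i hi
  simpa [totN, tabLen, length_sufV] using h

/-- The clean block on the wires of the layout. [folklore] -/
def opsFinB (n : ℕ) : List (ClOp (Fin (n + ((P.k₁ n + P.k₂ n) + P.mW hbf n)))) :=
  (P.opsN hbf n).map (ClOp.map (finOf _ (P.layoutN_pos hbf n)))

/-- The re-indexed block is well formed. [folklore] -/
theorem opsFinB_wf (n : ℕ) : ∀ op ∈ P.opsFinB hbf n, op.WF := by
  intro op hop
  simp only [opsFinB, List.mem_map] at hop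
  obtain ⟨op, hop, rfl⟩ := hop
  exact wf_map_finOf _ (P.opsN_lt hbf n op hop) (cleanOps_wf op hop)

/-- **The block of the shift experiment**: the exact Clifford+T compilation of the clean reversible
block of the machine of `blockFn`. [cite: Shor1997, §3 pp.8–10; Kitaev1995, §2.2 Lemma 1] -/
def VB (n : ℕ) : QCircuit cliffordT (n + ((P.k₁ n + P.k₂ n) + P.mW hbf n)) :=
  ⟨revCompile (toRevList (P.opsFinB hbf n) (P.opsFinB_wf hbf n))⟩

/-- The block is oracle-free. [folklore] -/
theorem VB_isOracleFree (n : ℕ) : (P.VB hbf n).IsOracleFree := revCompile_isOracleFree _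

/-! ### Basis-state semantics -/

/-- The label `x y ρ` extended to `ℕ` (as `ModExpBlock.liftW_tri`, a private copy). [folklore] -/
private theorem liftW_tri {n k m : ℕ} (x : QReg n) (y : QReg k) (ρ : QReg m) (i : ℕ) :
    liftW (tri x y ρ) i = if h : i < n then x ⟨i, h⟩ else if h' : i < n + k then y ⟨i - n, by omega⟩
      else if h'' : i < n + (k + m) then ρ ⟨i - n - k, by omega⟩ else false := by
  unfold liftW
  by_cases h1 : i < n
  · rw [dif_pos (by omega), dif_pos h1]
    exact tri_castAdd x y ρ ⟨i, h1⟩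
  rw [dif_neg h1]
  by_cases h2 : i < n + k
  · rw [dif_pos (by omega), dif_pos h2]
    have : (⟨i, by omega⟩ : Fin (n + (k + m))) = coinWire n k m ⟨i - n, by omega⟩ := by
      ext; simp [val_coinWire]; omega
    rw [this, tri_coinWire]
  rw [dif_neg h2]
  by_cases h3 : i < n + (k + m)
  · rw [dif_pos h3, dif_pos h3]
    have : (⟨i, h3⟩ : Fin (n + (k + m))) = Fin.natAdd n (Fin.natAdd k ⟨i - n - k, by omega⟩) := by
      ext; simp; omega
    rw [this, tri_work]
  · rw [dif_neg h3, dif_neg h3]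

/-- The coin input extended to `ℕ` is the string assignment of `x ++ c`. [folklore] -/
theorem liftW_coinInput {n k m : ℕ} (x : QReg n) (c : QReg k) :
    liftW (coinInput (m := m) x c) = strW (List.ofFn x ++ List.ofFn c) := by
  funext i
  rw [coinInput_eq_tri, liftW_tri, strW]
  by_cases h1 : i < n
  · rw [dif_pos h1, List.getD_append _ _ _ _ (by simpa using h1), List.getD_eq_getElem _ _ (by simpa using h1),
      List.getElem_ofFn]
  rw [dif_neg h1, List.getD_append_right _ _ _ _ (by simp; omega)]
  by_cases h2 : i < n + k
  · rw [dif_pos h2, List.getD_eq_getElem _ _ (by simp; omega), List.getElem_ofFn]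
    simp
  · rw [dif_neg h2, List.getD_eq_default _ _ (by simp; omega)]
    split_ifs <;> rfl

variable {n : ℕ}

/-- The tableau input of the block on input `x` and coins `c`. [folklore] -/
def inpOf (x : QReg n) (c : QReg (P.k₁ n + P.k₂ n)) : List Bool := List.ofFn x ++ List.ofFn c ++ sufV n

/-- The controls among the coins. [folklore] -/
def ysOf (c : QReg (P.k₁ n + P.k₂ n)) : List Bool := (List.ofFn c).take (P.k₁ n)

/-- The offsets among the coins. [folklore] -/
def zsOf (c : QReg (P.k₁ n + P.k₂ n)) : List Bool := (List.ofFn c).drop (P.k₁ n)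

/-- The controls have length `k₁`. [folklore] -/
theorem length_ysOf (c : QReg (P.k₁ n + P.k₂ n)) : (P.ysOf c).length = P.k₁ n := by simp [ysOf]

/-- The offsets have length `k₂`. [folklore] -/
theorem length_zsOf (c : QReg (P.k₁ n + P.k₂ n)) : (P.zsOf c).length = P.k₂ n := by simp [zsOf]

/-- The tableau input is the tableau of the parsed parts. [folklore] -/
theorem inpOf_eq_tabOf (x : QReg n) (c : QReg (P.k₁ n + P.k₂ n)) :
    P.inpOf x c = tabOf (List.ofFn x) (P.ysOf c) (P.zsOf c) := by
  rw [inpOf, tabOf, ysOf, zsOf, List.append_assoc (List.ofFn x) (List.take _ _), List.take_append_drop,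
    List.length_ofFn]

/-- The tableau input has length `tabLen`. [folklore] -/
theorem length_inpOf (x : QReg n) (c : QReg (P.k₁ n + P.k₂ n)) : (P.inpOf x c).length = P.tabLen n := by
  have h := length_tabOf (P := P) (w := List.ofFn x) (ys := P.ysOf c) (zs := P.zsOf c)
    (by rw [List.length_ofFn]; exact P.length_ysOf c) (by rw [List.length_ofFn]; exact P.length_zsOf c)
  rw [inpOf_eq_tabOf, h, List.length_ofFn]

/-- **The table argument of unit `u`** on coins `c`. [cite: Kitaev1995, §3 Lemma 10] -/
def coinArg (c : QReg (P.k₁ n + P.k₂ n)) (u : ℕ) : ℕ := P.unitArg n (P.ysOf c) (P.zsOf c) u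

/-- **The block machine's output on the block's tableau input**: the coded list of the unit values.
[cite: Jozsa2003, §10 (proof of Thm. 6)] -/
theorem blockFn_inpOf (x : QReg n) (c : QReg (P.k₁ n + P.k₂ n)) :
    P.blockFn tab (P.inpOf x c) = encList ((List.range (P.nU n)).map fun u => tab (List.ofFn x) (P.coinArg c u)) := by
  have h := units_tabOf (P := P) (w := List.ofFn x) (ys := P.ysOf c) (zs := P.zsOf c)
    (by rw [List.length_ofFn]; exact P.length_ysOf c) (by rw [List.length_ofFn]; exact P.length_zsOf c) tab
  rw [blockFn, inpOf_eq_tabOf, h, List.length_ofFn]; rfl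

/-- **The work register** of the block's output on `|x⟩|c⟩|0…0⟩`: the read-out code of
`blockFn (inpOf x c)` on the result wires, zeros elsewhere. [folklore] -/
def resOf (x : QReg n) (c : QReg (P.k₁ n + P.k₂ n)) : QReg (P.mW hbf n) :=
  fun j => readOut (eB hbf) (MB hbf) (P.tabLen n) (P.blockFn tab (P.inpOf x c)) (P.dataN n + j)

/-- **Semantics of the block on basis inputs**: `VB |x⟩|c⟩|0^{mW}⟩ = |x⟩|c⟩|resOf x c⟩` (Bennett's
compute–copy–uncompute, `RevClean.clEval_cleanOps`, compiled exactly, `revCompile_mulVec_basisState`).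
[cite: Shor1997, §3 p.8 (compute F(x) keeping x, copy, undo); Kitaev1995, §2.2 Lemma 1] -/
theorem VB_mulVec_basisState (x : QReg n) (c : QReg (P.k₁ n + P.k₂ n)) :
    (P.VB hbf n).toMatrix 0 *ᵥ basisState (coinInput x c) = basisState (tri x c (P.resOf hbf x c)) := by
  rw [VB, revCompile_mulVec_basisState]
  congr 1
  have hM0 := MB_outputsWithin hbf (P.inpOf x c)
  rw [length_inpOf, tabLen, inpOf, show P.dataN n = (List.ofFn x ++ List.ofFn c).length by simp [dataN]] at hM0
  have hM : (MB hbf).OutputsWithin ((List.ofFn x ++ List.ofFn c) ++ sufV n)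
      (P.blockFn tab ((List.ofFn x ++ List.ofFn c) ++ sufV n))
      (Tn (eB hbf) ((List.ofFn x ++ List.ofFn c).length + (sufV n).length)) := by rwa [length_sufV]
  have key : ∀ p : Fin (n + ((P.k₁ n + P.k₂ n) + P.mW hbf n)),
      revEval (toRevList (P.opsFinB hbf n) (P.opsFinB_wf hbf n)) (coinInput x c) p =
        liftW (tri x c (P.resOf hbf x c)) p := by
    intro p
    rw [revEval_toRevList, opsFinB, clEval_map_finOf_apply _ _ (P.opsN_lt hbf _), liftW_coinInput, opsN,
      show P.dataN n = (List.ofFn x ++ List.ofFn c).length by simp [dataN], clEval_cleanOps _ _ _ hM, liftW_tri]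
    dsimp only
    have hp := p.isLt
    by_cases h1 : (p : ℕ) < n
    · rw [if_pos (by simp; omega), dif_pos h1, List.getD_append _ _ _ _ (by simpa using h1),
        List.getD_eq_getElem _ _ (by simpa using h1), List.getElem_ofFn]
    rw [dif_neg h1]
    by_cases h2 : (p : ℕ) < n + (P.k₁ n + P.k₂ n)
    · rw [if_pos (by simpa using h2), dif_pos h2, List.getD_append_right _ _ _ _ (by simp; omega),
        List.getD_eq_getElem _ _ (by simp; omega), List.getElem_ofFn]
      simp
    · rw [if_neg (by simpa using h2), dif_neg h2, dif_pos hp, resOf, inpOf]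
      simp only [List.length_append, List.length_ofFn, tabLen, dataN, length_sufV]
      congr 1
      omega
  funext p
  rw [key, liftW_val]

/-! ### The work register determines and is determined by the unit values -/

/-- `encList` is injective (as `ModExpBlock.encList_injective`, a private copy). [folklore] -/
private theorem encList_injective : Function.Injective encList := by
  intro l₁
  induction l₁ with
  | nil =>
    intro l₂ h
    cases l₂ with
    | nil => rfl
    | cons a l₂ => exact absurd h.symm (QCircuit.boolPair_ne_nil _ _)
  | cons a l₁ ih =>
    intro l₂ h
    cases l₂ with
    | nil => exact absurd h (QCircuit.boolPair_ne_nil _ _)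
    | cons b l₂ =>
      rw [encList_cons, encList_cons] at h
      obtain ⟨rfl, h2⟩ := QCircuit.boolPair_inj h
      rw [ih h2]

/-- The whole read-out of the block's output is determined by the work register. [folklore] -/
theorem readOut_eq_of_resOf_eq {x : QReg n} {c c' : QReg (P.k₁ n + P.k₂ n)}
    (h : P.resOf hbf x c = P.resOf hbf x c') :
    readOut (eB hbf) (MB hbf) (P.tabLen n) (P.blockFn tab (P.inpOf x c)) =
      readOut (eB hbf) (MB hbf) (P.tabLen n) (P.blockFn tab (P.inpOf x c')) := by
  funext i
  have hNN : P.tabLen n ≤ NN (eB hbf) (MB hbf) (P.tabLen n) := le_NN _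
  have htab : P.dataN n ≤ P.tabLen n := Nat.le_add_right _ _
  have hwid : P.totN hbf n = NN (eB hbf) (MB hbf) (P.tabLen n) + copyN (eB hbf) (MB hbf) (P.tabLen n) := rfl
  by_cases h1 : i < P.dataN n
  · rw [readOut, readOut, if_neg (by omega), if_neg (by omega)]
  · by_cases h2 : i < P.totN hbf n
    · have := congrFun h ⟨i - P.dataN n, by unfold mW; omega⟩
      simp only [resOf] at this
      rwa [show P.dataN n + (i - P.dataN n) = i by omega] at this
    · rw [readOut, readOut, if_neg (by omega), if_neg (by omega)]

/-- **The work register determines and is determined by the unit values.** [cite: Kitaev1995, §2.2 Lemma 1; Shor1997, §3 (no garbage)] -/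
theorem resOf_eq_iff (x : QReg n) (c c' : QReg (P.k₁ n + P.k₂ n)) :
    P.resOf hbf x c = P.resOf hbf x c' ↔
      ∀ u < P.nU n, tab (List.ofFn x) (P.coinArg c u) = tab (List.ofFn x) (P.coinArg c' u) := by
  constructor
  · intro h u hu
    have hro := P.readOut_eq_of_resOf_eq hbf h
    have h₁ := MB_outputsWithin hbf (P.inpOf x c)
    have h₂ := MB_outputsWithin hbf (P.inpOf x c')
    rw [length_inpOf] at h₁ h₂
    have hl := eq_of_readOut_eq (P.length_inpOf x c) (P.length_inpOf x c') h₁ h₂ hro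
    rw [blockFn_inpOf, blockFn_inpOf] at hl
    exact List.map_eq_map_iff.1 (encList_injective hl) u (List.mem_range.2 hu)
  · intro h
    have hl : P.blockFn tab (P.inpOf x c) = P.blockFn tab (P.inpOf x c') := by
      rw [blockFn_inpOf, blockFn_inpOf]
      exact congrArg encList (List.map_congr_left fun u hu => h u (List.mem_range.1 hu))
    funext j
    change readOut _ _ _ (P.blockFn tab (P.inpOf x c)) _ = readOut _ _ _ (P.blockFn tab (P.inpOf x c')) _
    rw [hl]

end SSParams

end ShiftSampling

end Literature.Computability.Cryptography

end
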